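import Summits.AtomisticToContinuum.FouriersLaw.Theorems.HonestZwanzigRobinCoercivityStubImsLocalisationAux

/-!
# Discrete IMS localisation formula on a line (stub `stub_imsLocalisation`)

Support file for the crux `stmt-AtomisticToContinuum-12695` (`HonestZwanzig.RobinCoercivity`), line
`limit-operator-memory-form`. Pure finite-dimensional real analysis, no project definitions.

On a line of `M` points, window coercivity `c` of a symmetric matrix `W` on (i) the first `A + 2L` points, (ii) the
last `A + 2L` points, (iii) every bulk window `[a, a + 2L)` at distance `≥ A` from both ends, together with the
off-band commutator bound `Σ_j min(1, (i−j)²/L²)|W_ij| ≤ E` for every row, give global coercivity `c − 5E`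
(Cycon–Froese–Kirsch–Simon, *Schrödinger Operators* §3.1, Thm 3.2, IMS localisation formula, discrete version).

Proof: the sine/cosine partition of unity `Σ_k χ_k² = 1` of the auxiliary file
(`HonestZwanzigRobinCoercivityStubImsLocalisationAux.lean`; windows `k = 0, …, K` evaluated at the clamped ramp
coordinate `t_i = min (i − (A+L)) (KL)` of site `i`), the IMS identity
`ζᵀWζ = Σ_k (χ_kζ)ᵀW(χ_kζ) + Σ_{ij} ρ_ij W_ij ζ_i ζ_j` with `ρ_ij = 1 − Σ_k χ_k(i)χ_k(j)`, the kernel bound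
`0 ≤ ρ_ij ≤ 5·min(1,(i−j)²/L²)` (from the great-circle bound `Σ_k χ_k(i)χ_k(j) ≥ 1 − π²(i−j)²/(8L²)`), and Schur's
test for the error term (`≤ 5E|ζ|²`). The number of ramps `K` is chosen so that window `0` lives in the first
`A + 2L` sites, window `K` in the last `A + 2L` sites, and windows `1 ≤ k ≤ K − 1` in bulk windows.

As in the auxiliary file, no definitions are introduced: the profile `g` and the windows `χ` are free function
variables pinned down by their defining equations `hg`, `hχ`.
-/

noncomputable section

open Real Finset

namespace Summit.AtomisticToContinuum.FouriersLaw.Theorems.HonestZwanzig.Robin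

/-! ### Sites, clamped coordinates `t_i = min (i - (A + L)) (K L)`, kernel bound and window supports -/

section Sites

variable {L : ℕ} {g : ℝ → ℝ} {χ : ℕ → ℕ → ℝ}

/-- Kernel bound at sites: `1 - Σ_k χ_k(t_i) χ_k(t_j) ≤ 5 · min (1, (i - j)² / L²)` for all sites `i, j`. -/
theorem ims_rho_bound (hg : ∀ x, g x = Real.cos (max (-(π / 2)) (min (π / 2) x)))
    (hχ : ∀ k t, χ k t = g (π * ((t : ℝ) - k * L) / (2 * L))) (hL : 1 ≤ L) {K : ℕ} (hK : 1 ≤ K)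
    (A i j : ℕ) :
    1 - ∑ k ∈ Finset.range (K + 1),
        χ k (min (i - (A + L)) (K * L)) * χ k (min (j - (A + L)) (K * L)) ≤
      5 * min 1 (((i : ℝ) - j) ^ 2 / (L : ℝ) ^ 2) := by
  rw [mul_min_of_nonneg _ _ (by norm_num : (0 : ℝ) ≤ 5), mul_one]
  refine le_min ?_ ?_
  · have hS : 0 ≤ ∑ k ∈ Finset.range (K + 1),
        χ k (min (i - (A + L)) (K * L)) * χ k (min (j - (A + L)) (K * L)) :=
      Finset.sum_nonneg fun k _ => mul_nonneg (ims_chi_nonneg hg hχ _ _) (ims_chi_nonneg hg hχ _ _)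
    linarith
  · rcases le_total i j with h | h
    · exact imsOverlapBound hg hχ hL hK (min_le_right _ _) (min_le_right _ _) (by omega) (by omega)
    · have hcomm : ∑ k ∈ Finset.range (K + 1),
          χ k (min (i - (A + L)) (K * L)) * χ k (min (j - (A + L)) (K * L)) =
          ∑ k ∈ Finset.range (K + 1),
            χ k (min (j - (A + L)) (K * L)) * χ k (min (i - (A + L)) (K * L)) :=
        Finset.sum_congr rfl fun _ _ => mul_comm _ _
      have hsq : ((i : ℝ) - j) ^ 2 = ((j : ℝ) - i) ^ 2 := by ring
      rw [hcomm, hsq]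
      exact imsOverlapBound hg hχ hL hK (min_le_right _ _) (min_le_right _ _) (by omega) (by omega)

/-- The left window `χ_0` is supported in the first `A + 2L` sites. -/
theorem ims_chi_left_zero (hg : ∀ x, g x = Real.cos (max (-(π / 2)) (min (π / 2) x)))
    (hχ : ∀ k t, χ k t = g (π * ((t : ℝ) - k * L) / (2 * L))) (hL : 1 ≤ L) {K A i : ℕ} (hK : 1 ≤ K)
    (hi : A + 2 * L ≤ i) : χ 0 (min (i - (A + L)) (K * L)) = 0 := by
  apply ims_chi_eq_zero_of_ge hg hχ hL
  have : L ≤ K * L := Nat.le_mul_of_pos_left L hK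
  omega

/-- The right window `χ_K` is supported in the last `A + 2L` sites (when `M ≤ KL + 2A + 2L`). -/
theorem ims_chi_right_zero (hg : ∀ x, g x = Real.cos (max (-(π / 2)) (min (π / 2) x)))
    (hχ : ∀ k t, χ k t = g (π * ((t : ℝ) - k * L) / (2 * L))) (hL : 1 ≤ L) {M K A i : ℕ} (hK : 1 ≤ K)
    (hM : M ≤ K * L + 2 * A + 2 * L) (hi : i + (A + 2 * L) < M) :
    χ K (min (i - (A + L)) (K * L)) = 0 := by
  apply ims_chi_eq_zero_of_le hg hχ hL
  have : L ≤ K * L := Nat.le_mul_of_pos_left L hK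
  omega

/-- The bulk window `χ_k`, `1 ≤ k ≤ K - 1`, is supported in `[A + kL, A + kL + 2L)`. -/
theorem ims_chi_bulk_zero (hg : ∀ x, g x = Real.cos (max (-(π / 2)) (min (π / 2) x)))
    (hχ : ∀ k t, χ k t = g (π * ((t : ℝ) - k * L) / (2 * L))) (hL : 1 ≤ L) {K A k i : ℕ} (hk : 1 ≤ k)
    (hkK : k + 1 ≤ K) (hi : i < A + k * L ∨ A + k * L + 2 * L ≤ i) :
    χ k (min (i - (A + L)) (K * L)) = 0 := by
  have h1 : L ≤ k * L := Nat.le_mul_of_pos_left L hk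
  have h2 : k * L + L ≤ K * L := by
    have := Nat.mul_le_mul_right L hkK
    rwa [add_one_mul] at this
  rcases hi with hi | hi
  · apply ims_chi_eq_zero_of_le hg hχ hL
    omega
  · apply ims_chi_eq_zero_of_ge hg hχ hL
    omega

end Sites

/-- Choice of the number of ramps `K`: `K ≥ 1`, the right window reaches the last `A + 2L` sites, and every bulk
window `[A + kL, A + kL + 2L)`, `1 ≤ k ≤ K - 1`, stays at distance `≥ A` from the right end. -/
theorem ims_numWindows (M A L : ℕ) (hL : 1 ≤ L) :
    ∃ K : ℕ, 1 ≤ K ∧ M ≤ K * L + 2 * A + 2 * L ∧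
      ∀ k, 1 ≤ k → k + 1 ≤ K → A + k * L + 2 * L + A ≤ M := by
  obtain ⟨q, hq1, hq2⟩ : ∃ q, q * L ≤ M - (2 * A + 2 * L) ∧ M - (2 * A + 2 * L) < q * L + L :=
    ⟨(M - (2 * A + 2 * L)) / L, Nat.div_mul_le_self _ _, Nat.lt_div_mul_add hL⟩
  refine ⟨q + 1, by omega, ?_, ?_⟩
  · rw [add_one_mul]; omega
  · intro k hk hkK
    have hkq : k * L ≤ q * L := Nat.mul_le_mul_right L (by omega)
    have hLk : L ≤ k * L := Nat.le_mul_of_pos_left L hk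
    omega

/-! ### The localisation formula -/

/-- **Discrete IMS localisation formula on a line.** On `M` sites, if a symmetric matrix `W` is `c`-coercive on
vectors supported in the first `A + 2L` sites, in the last `A + 2L` sites, and in every bulk window `[a, a + 2L)` with
`A ≤ a`, `a + 2L + A ≤ M`, and every row satisfies the off-band bound `Σ_j min(1, (i−j)²/L²)|W_ij| ≤ E`, then `W` is
`(c − 5E)`-coercive (Cycon–Froese–Kirsch–Simon, Schrödinger Operators, Thm 3.2, discrete version with ramps of
length `L ≥ 1`). -/
theorem stub_imsLocalisation : ∀ (M A L : ℕ), 1 ≤ L → ∀ (W : Fin M → Fin M → ℝ), (∀ i j, W i j = W j i) →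
    ∀ (c E : ℝ),
    (∀ v : Fin M → ℝ, (∀ i : Fin M, A + 2 * L ≤ i.val → v i = 0) →
      c * ∑ i, v i ^ 2 ≤ ∑ i, ∑ j, v i * W i j * v j) →
    (∀ v : Fin M → ℝ, (∀ i : Fin M, i.val + (A + 2 * L) < M → v i = 0) →
      c * ∑ i, v i ^ 2 ≤ ∑ i, ∑ j, v i * W i j * v j) →
    (∀ a : ℕ, A ≤ a → a + 2 * L + A ≤ M → ∀ v : Fin M → ℝ,
      (∀ i : Fin M, i.val < a ∨ a + 2 * L ≤ i.val → v i = 0) →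
      c * ∑ i, v i ^ 2 ≤ ∑ i, ∑ j, v i * W i j * v j) →
    (∀ i : Fin M, ∑ j : Fin M, min 1 (((i.val : ℝ) - j.val) ^ 2 / (L : ℝ) ^ 2) * |W i j| ≤ E) →
    ∀ ζ : Fin M → ℝ, (c - 5 * E) * ∑ i, ζ i ^ 2 ≤ ∑ i, ∑ j, ζ i * W i j * ζ j := by
  intro M A L hL W hsym c E hwL hwR hwB hE ζ
  obtain ⟨K, hK, hM1, hbulk⟩ := ims_numWindows M A L hL
  -- the profile, the windows, their restriction to the sites, and the overlap kernel
  obtain ⟨g, hg⟩ : ∃ g : ℝ → ℝ, ∀ x, g x = Real.cos (max (-(π / 2)) (min (π / 2) x)) :=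
    ⟨_, fun _ => rfl⟩
  obtain ⟨χ, hχ⟩ : ∃ χ : ℕ → ℕ → ℝ, ∀ k t, χ k t = g (π * ((t : ℝ) - k * L) / (2 * L)) :=
    ⟨_, fun _ _ => rfl⟩
  obtain ⟨X, hX⟩ : ∃ X : ℕ → Fin M → ℝ, ∀ k i, X k i = χ k (min (i.val - (A + L)) (K * L)) :=
    ⟨_, fun _ _ => rfl⟩
  obtain ⟨S, hS⟩ : ∃ S : Fin M → Fin M → ℝ,
      ∀ i j, S i j = ∑ k ∈ Finset.range (K + 1), X k i * X k j := ⟨_, fun _ _ => rfl⟩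
  have hpu : ∀ i : Fin M, ∑ k ∈ Finset.range (K + 1), X k i ^ 2 = 1 := fun i => by
    simp only [hX]
    exact ims_chi_sum_sq hg hχ hL hK (min_le_right _ _)
  have hSsymm : ∀ i j, S i j = S j i := fun i j => by
    rw [hS, hS]
    exact Finset.sum_congr rfl fun k _ => mul_comm _ _
  have hρ0 : ∀ i j, 0 ≤ 1 - S i j := fun i j => by
    rw [hS]
    simp only [hX]
    exact ims_rho_nonneg hg hχ hL hK (min_le_right _ _) (min_le_right _ _)
  have hρ : ∀ i j : Fin M, 1 - S i j ≤ 5 * min 1 (((i.val : ℝ) - j.val) ^ 2 / (L : ℝ) ^ 2) :=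
    fun i j => by
    rw [hS]
    simp only [hX]
    exact ims_rho_bound hg hχ hL hK A i.val j.val
  -- window coercivity, from the three hypotheses
  have hwin : ∀ k ∈ Finset.range (K + 1),
      c * ∑ i, (X k i * ζ i) ^ 2 ≤ ∑ i, ∑ j, (X k i * ζ i) * W i j * (X k j * ζ j) := by
    intro k hk
    have hkK : k ≤ K := Nat.lt_succ_iff.mp (Finset.mem_range.mp hk)
    rcases Nat.eq_zero_or_pos k with rfl | hk0
    · exact hwL (fun i => X 0 i * ζ i) fun i hi => by
        show X 0 i * ζ i = 0
        rw [hX, ims_chi_left_zero hg hχ hL hK hi, zero_mul]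
    · rcases hkK.eq_or_lt with heq | hlt
      · exact hwR (fun i => X k i * ζ i) fun i hi => by
          show X k i * ζ i = 0
          rw [hX, heq, ims_chi_right_zero hg hχ hL hK hM1 hi, zero_mul]
      · exact hwB (A + k * L) (Nat.le_add_right _ _) (hbulk k hk0 (by omega))
          (fun i => X k i * ζ i) fun i hi => by
          show X k i * ζ i = 0
          rw [hX, ims_chi_bulk_zero hg hχ hL hk0 (by omega) hi, zero_mul]
  -- the IMS identity
  have hIMS : ∑ i, ∑ j, ζ i * W i j * ζ j =
      (∑ k ∈ Finset.range (K + 1), ∑ i, ∑ j, (X k i * ζ i) * W i j * (X k j * ζ j)) +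
        ∑ i, ∑ j, (1 - S i j) * (ζ i * W i j * ζ j) := by
    have hx : ∑ k ∈ Finset.range (K + 1), ∑ i, ∑ j, (X k i * ζ i) * W i j * (X k j * ζ j) =
        ∑ i, ∑ j, S i j * (ζ i * W i j * ζ j) := by
      rw [Finset.sum_comm]
      refine Finset.sum_congr rfl fun i _ => ?_
      rw [Finset.sum_comm]
      refine Finset.sum_congr rfl fun j _ => ?_
      rw [hS, Finset.sum_mul]
      refine Finset.sum_congr rfl fun k _ => ?_
      ring
    rw [hx, ← Finset.sum_add_distrib]
    refine Finset.sum_congr rfl fun i _ => ?_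
    rw [← Finset.sum_add_distrib]
    refine Finset.sum_congr rfl fun j _ => ?_
    ring
  -- the window terms add up to `c |ζ|²`
  have hmain : c * ∑ i, ζ i ^ 2 ≤
      ∑ k ∈ Finset.range (K + 1), ∑ i, ∑ j, (X k i * ζ i) * W i j * (X k j * ζ j) := by
    have e : c * ∑ i, ζ i ^ 2 = ∑ k ∈ Finset.range (K + 1), c * ∑ i, (X k i * ζ i) ^ 2 := by
      rw [← Finset.mul_sum, Finset.sum_comm]
      congr 1
      refine Finset.sum_congr rfl fun i _ => ?_
      calc ζ i ^ 2 = (∑ k ∈ Finset.range (K + 1), X k i ^ 2) * ζ i ^ 2 := by rw [hpu, one_mul]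
        _ = ∑ k ∈ Finset.range (K + 1), (X k i * ζ i) ^ 2 := by
          rw [Finset.sum_mul]
          exact Finset.sum_congr rfl fun k _ => by ring
    rw [e]
    exact Finset.sum_le_sum hwin
  -- Schur bound on the error term
  have hrow : ∀ i : Fin M, ∑ j, (1 - S i j) * |W i j| ≤ 5 * E := by
    intro i
    calc ∑ j, (1 - S i j) * |W i j|
        ≤ ∑ j, 5 * (min 1 (((i.val : ℝ) - j.val) ^ 2 / (L : ℝ) ^ 2) * |W i j|) :=
          Finset.sum_le_sum fun j _ => by
            have := mul_le_mul_of_nonneg_right (hρ i j) (abs_nonneg (W i j))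
            linarith
      _ = 5 * ∑ j, min 1 (((i.val : ℝ) - j.val) ^ 2 / (L : ℝ) ^ 2) * |W i j| := by
          rw [Finset.mul_sum]
      _ ≤ 5 * E := by linarith [hE i]
  have hcol : ∀ j : Fin M, ∑ i, (1 - S i j) * |W i j| ≤ 5 * E := by
    intro j
    have : ∑ i, (1 - S i j) * |W i j| = ∑ i, (1 - S j i) * |W j i| :=
      Finset.sum_congr rfl fun i _ => by rw [hSsymm, hsym]
    rw [this]
    exact hrow j
  have hpt : ∀ i j, -((1 - S i j) * |W i j| * ζ i ^ 2 / 2 + (1 - S i j) * |W i j| * ζ j ^ 2 / 2) ≤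
      (1 - S i j) * (ζ i * W i j * ζ j) := by
    intro i j
    have hr := hρ0 i j
    have hw := abs_nonneg (W i j)
    have hab : 2 * |ζ i| * |ζ j| ≤ |ζ i| ^ 2 + |ζ j| ^ 2 := two_mul_le_add_sq _ _
    rw [sq_abs, sq_abs] at hab
    have h3 : -(|W i j| * (ζ i ^ 2 + ζ j ^ 2) / 2) ≤ ζ i * W i j * ζ j := by
      have h4 : |ζ i * W i j * ζ j| = |ζ i| * |W i j| * |ζ j| := by rw [abs_mul, abs_mul]
      have h5 := neg_abs_le (ζ i * W i j * ζ j)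
      nlinarith [mul_le_mul_of_nonneg_left hab hw]
    nlinarith [mul_le_mul_of_nonneg_left h3 hr]
  have hlow : ∑ i, ∑ j, -((1 - S i j) * |W i j| * ζ i ^ 2 / 2 + (1 - S i j) * |W i j| * ζ j ^ 2 / 2) ≤
      ∑ i, ∑ j, (1 - S i j) * (ζ i * W i j * ζ j) :=
    Finset.sum_le_sum fun i _ => Finset.sum_le_sum fun j _ => hpt i j
  have hsplit : ∑ i, ∑ j, -((1 - S i j) * |W i j| * ζ i ^ 2 / 2 + (1 - S i j) * |W i j| * ζ j ^ 2 / 2) =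
      -(∑ i, ∑ j, (1 - S i j) * |W i j| * ζ i ^ 2 / 2) -
        ∑ i, ∑ j, (1 - S i j) * |W i j| * ζ j ^ 2 / 2 := by
    simp only [Finset.sum_neg_distrib, Finset.sum_add_distrib]
    ring
  have eA : ∑ i, ∑ j, (1 - S i j) * |W i j| * ζ i ^ 2 / 2 =
      ∑ i, (∑ j, (1 - S i j) * |W i j|) * ζ i ^ 2 / 2 :=
    Finset.sum_congr rfl fun i _ => by rw [Finset.sum_mul, Finset.sum_div]
  have eB : ∑ i, ∑ j, (1 - S i j) * |W i j| * ζ j ^ 2 / 2 =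
      ∑ j, (∑ i, (1 - S i j) * |W i j|) * ζ j ^ 2 / 2 := by
    rw [Finset.sum_comm]
    exact Finset.sum_congr rfl fun j _ => by rw [Finset.sum_mul, Finset.sum_div]
  have hA : ∑ i, (∑ j, (1 - S i j) * |W i j|) * ζ i ^ 2 / 2 ≤ ∑ i, 5 * E * ζ i ^ 2 / 2 :=
    Finset.sum_le_sum fun i _ => by
      linarith [mul_le_mul_of_nonneg_right (hrow i) (sq_nonneg (ζ i))]
  have hB : ∑ j, (∑ i, (1 - S i j) * |W i j|) * ζ j ^ 2 / 2 ≤ ∑ j, 5 * E * ζ j ^ 2 / 2 :=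
    Finset.sum_le_sum fun j _ => by
      linarith [mul_le_mul_of_nonneg_right (hcol j) (sq_nonneg (ζ j))]
  have hC : ∑ i, 5 * E * ζ i ^ 2 / 2 = 5 * E * (∑ i, ζ i ^ 2) / 2 := by
    rw [Finset.mul_sum, Finset.sum_div]
  rw [hIMS]
  have hexp : (c - 5 * E) * ∑ i, ζ i ^ 2 = c * ∑ i, ζ i ^ 2 - 5 * E * ∑ i, ζ i ^ 2 := by ring
  rw [hexp]
  linarith [hmain, hlow, hsplit, eA, eB, hA, hB, hC]

end Summit.AtomisticToContinuum.FouriersLaw.Theorems.HonestZwanzig.Robin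

end
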